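import Summits.QuantumFields.YangMills.Theorems.UnitScaleTiltProp7BondAvgIterCoercivity
import HarnessLib

/-!
# Route `UnitScaleTilt`, crux K1 «MinimiserStabilityRegPr» (stmt-QuantumFields-19200), route-R [RP] curved, the curved N6 row (R-C), transport geometry, Step A geometry —
# THE ONE-STROKE INDEX SPLITS LEVEL BY LEVEL: `(r, t₁; ρ, t₀) ↦ (r·L^k + ρ, t₁L^k + t₀)` IS A BIJECTION `{children} × [0,L) × B^k-offsets × [0,L^k) ≅ B^{k+1}-offsets × [0,L^{k+1})`
# COMPATIBLE WITH THE BOND MAP: `shift^{t₀}(fibreSite 0 k (shift^{t₁}(blockSite y r)) ρ) = shift^{t₁L^k + t₀}(fibreSite 0 (k+1) y (r·L^k + ρ))`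

Cell `ym3-torus`, width seat `ym-ust-20520-w2` (g3).  The lattice half of Step A of the memo `RC-TRANSPORT-GEOMETRY-w2g3.md` (19200 evidence): iterating ✓ p609588
`line_of_transported_family_fin` writes the pure `LINE`-iterate `S_k` as a transported family over `(Idx P × Fin L)^k`; THIS file is the bookkeeping that the bonds it reaches
are EXACTLY the one-stroke terms `(x ∈ B^k(c₋), t < L^k) ↦ (x + te_μ, μ)` of the engine's `A^{U₀}` (✓ p609108 `sum_block_lines`), level by level, in test-function form
(so multiplicities transfer without an explicit global bijection).  Built on ★p1's fibre calculus (`Prop7FlatCoercivity.fibreSite_runSite`, `iterate_shift_eq_runSite`,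
`sum_range_mul_eq`) and `finProdFinEquiv`.  THEOREMS ONLY (0 `def`, 0 `sorry`); `--supports stmt-QuantumFields-19200`, count-neutral.  YM₃ on T³ is a ladder rung (R3), not the
Clay problem; nothing here claims the curved N6, S2, P, the crux or the gap.

WHAT IS PROVED (ns `…Theorems.Prop7OneStrokeSplit`; the digit-combine is written `fun ν => finCongr (pow_succ' L k).symm (finProdFinEquiv (r ν, ρ ν))`, value `ρ ν + L^k·r ν`).
* §1 `fibreSite_blockSite` — `fibreSite 0 k (blockSite y r) ρ = fibreSite 0 (k+1) y (combine r ρ)` (standing range).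
* §2 `fibreSite_iterate_shift` — `fibreSite 0 k (x + te_μ) ρ = fibreSite 0 k x ρ + t·L^k e_μ`; ★ `oneStroke_src_succ` — the bond-map compatibility of the title.
* §3 ★★ `sum_oneStroke_succ` — `Σ_rΣ_{t₁<L}Σ_ρΣ_{t₀<L^k} F(combine r ρ, t₁L^k + t₀) = Σ_{r'}Σ_{t'<L^{k+1}} F(r', t')` for every test function `F`.
HONEST SCOPE.  Pure lattice bookkeeping (one level); the assembly `exists_lineIter_repr` iterating it with the transports is the next file.

References: T. Bałaban, CMP 95 (1984) 17–40 [Balaban1984PropagatorsI] ((1.6)–(1.8) pp.18–19, (1.18) p.20).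
-/

noncomputable section

open scoped BigOperators

namespace Summit.QuantumFields.YangMills.Theorems.Prop7OneStrokeSplit

open Literature.MathematicalPhysics.QuantumFieldTheory.Balaban1983to89
open Finset T4Continuum B1RG242Torus LatticeFieldCalculus
open Summit.QuantumFields.YangMills.Theorems.Prop7FlatCoercivity (fibreSite_runSite iterate_shift_eq_runSite sum_range_mul_eq)

variable {P : Params} {k : ℕ}

/-! ## §1 Digit combine: the `k`-fibre of a child is the `(k+1)`-fibre of the parent -/

/-- `fibreSite 0 k (blockSite y r) ρ = fibreSite 0 (k+1) y (ρ + L^k·r)` (standing range: the child's label is `yL + r`, no wrap). [cite: Balaban1984PropagatorsI, (1.6) p.18] -/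
theorem fibreSite_blockSite (hk1 : k + 1 ≤ P.m + P.K) (y : Site P (k + 1)) (r : Fin P.d → Fin P.L) (ρ : Fin P.d → Fin (P.L ^ k)) :
    Site.fibreSite 0 k (Site.blockSite y r) ρ
      = Site.fibreSite 0 (k + 1) y (fun ν => finCongr (pow_succ' P.L k).symm (finProdFinEquiv (r ν, ρ ν))) := by
  funext ν
  simp only [Site.fibreSite, finCongr_apply, Fin.val_cast, finProdFinEquiv_apply_val]
  rw [Site.val_blockSite hk1]
  push_cast
  ring

/-! ## §2 Shifting a `k`-site moves its fibre by `L^k` fine steps; the bond-map compatibility -/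

/-- `fibreSite 0 k (x + te_μ) ρ = fibreSite 0 k x ρ + t·L^k e_μ`. [cite: Balaban1984PropagatorsI, (1.8) p.19] -/
theorem fibreSite_iterate_shift (h : P.sitesPerDir 0 = P.L ^ k * P.sitesPerDir k) (x : Site P k) (μ : Fin P.d) (t : ℕ) (ρ : Fin P.d → Fin (P.L ^ k)) :
    Site.fibreSite 0 k ((fun z : Site P k => z.shift μ)^[t] x) ρ = (fun z : Site P 0 => z.shift μ)^[t * P.L ^ k] (Site.fibreSite 0 k x ρ) := by
  rw [iterate_shift_eq_runSite, iterate_shift_eq_runSite, fibreSite_runSite h]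

/-- ★ **BOND-MAP COMPATIBILITY OF THE ONE-STROKE SPLIT**: the fine site reached from the child `blockSite y r` shifted `t₁` times, fibre offset `ρ`, then `t₀` fine steps, is the
fine site of `(k+1)`-fibre offset `ρ + L^k·r` of `y` shifted `t₁L^k + t₀` times. [cite: Balaban1984PropagatorsI, (1.18) p.20] -/
theorem oneStroke_src_succ (hk1 : k + 1 ≤ P.m + P.K) (h : P.sitesPerDir 0 = P.L ^ k * P.sitesPerDir k) (y : Site P (k + 1)) (μ : Fin P.d)
    (r : Fin P.d → Fin P.L) (t₁ : ℕ) (ρ : Fin P.d → Fin (P.L ^ k)) (t₀ : ℕ) :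
    (fun z : Site P 0 => z.shift μ)^[t₀] (Site.fibreSite 0 k ((fun z : Site P k => z.shift μ)^[t₁] (Site.blockSite y r)) ρ)
      = (fun z : Site P 0 => z.shift μ)^[t₁ * P.L ^ k + t₀]
          (Site.fibreSite 0 (k + 1) y (fun ν => finCongr (pow_succ' P.L k).symm (finProdFinEquiv (r ν, ρ ν)))) := by
  rw [fibreSite_iterate_shift h, fibreSite_blockSite hk1, ← Function.iterate_add_apply, add_comm]

/-! ## §3 ★★ The split of the one-stroke double sum -/

/-- ★★ **THE ONE-STROKE INDEX SPLITS**: for every test function `F` on `(k+1)`-fibre offsets and step counts,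
`Σ_r Σ_{t₁<L} Σ_ρ Σ_{t₀<L^k} F(combine r ρ, t₁·L^k + t₀) = Σ_{r'} Σ_{t'<L^{k+1}} F(r', t')` — digits `(r, ρ) ↦ ρ + L^k·r` (`finProdFinEquiv` per coordinate) and
`(t₁, t₀) ↦ t₁L^k + t₀` (★p1's `sum_range_mul_eq`). [cite: Balaban1984PropagatorsI, (1.18) p.20] -/
theorem sum_oneStroke_succ {M : Type*} [AddCommMonoid M] (F : (Fin P.d → Fin (P.L ^ (k + 1))) → ℕ → M) :
    ∑ r : Fin P.d → Fin P.L, ∑ t₁ ∈ Finset.range P.L, ∑ ρ : Fin P.d → Fin (P.L ^ k), ∑ t₀ ∈ Finset.range (P.L ^ k),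
        F (fun ν => finCongr (pow_succ' P.L k).symm (finProdFinEquiv (r ν, ρ ν))) (t₁ * P.L ^ k + t₀)
      = ∑ r' : Fin P.d → Fin (P.L ^ (k + 1)), ∑ t' ∈ Finset.range (P.L ^ (k + 1)), F r' t' := by
  -- the digit-combine equivalence
  let E : (Fin P.d → Fin P.L) × (Fin P.d → Fin (P.L ^ k)) ≃ (Fin P.d → Fin (P.L ^ (k + 1))) :=
    (Equiv.arrowProdEquivProdArrow (Fin P.d) (fun _ => Fin P.L) (fun _ => Fin (P.L ^ k))).symm.trans
      (Equiv.piCongrRight fun _ => finProdFinEquiv.trans (finCongr (pow_succ' P.L k).symm))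
  have hE : ∀ (r : Fin P.d → Fin P.L) (ρ : Fin P.d → Fin (P.L ^ k)),
      E (r, ρ) = fun ν => finCongr (pow_succ' P.L k).symm (finProdFinEquiv (r ν, ρ ν)) := fun r ρ => rfl
  -- first the steps: `Σ_{t₁}Σ_{t₀} g(t₁L^k + t₀) = Σ_{t'<L^{k+1}} g t'`
  have hsteps : ∀ r' : Fin P.d → Fin (P.L ^ (k + 1)),
      ∑ t₁ ∈ Finset.range P.L, ∑ t₀ ∈ Finset.range (P.L ^ k), F r' (t₁ * P.L ^ k + t₀) = ∑ t' ∈ Finset.range (P.L ^ (k + 1)), F r' t' := by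
    intro r'
    rw [sum_range_mul_eq (F r') P.L (P.L ^ k), ← pow_succ']
  calc ∑ r : Fin P.d → Fin P.L, ∑ t₁ ∈ Finset.range P.L, ∑ ρ : Fin P.d → Fin (P.L ^ k), ∑ t₀ ∈ Finset.range (P.L ^ k),
          F (fun ν => finCongr (pow_succ' P.L k).symm (finProdFinEquiv (r ν, ρ ν))) (t₁ * P.L ^ k + t₀)
      = ∑ r : Fin P.d → Fin P.L, ∑ ρ : Fin P.d → Fin (P.L ^ k), ∑ t₁ ∈ Finset.range P.L, ∑ t₀ ∈ Finset.range (P.L ^ k),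
          F (E (r, ρ)) (t₁ * P.L ^ k + t₀) := by
        refine Finset.sum_congr rfl fun r _ => ?_
        rw [Finset.sum_comm]
        simp only [hE]
    _ = ∑ r : Fin P.d → Fin P.L, ∑ ρ : Fin P.d → Fin (P.L ^ k), ∑ t' ∈ Finset.range (P.L ^ (k + 1)), F (E (r, ρ)) t' := by
        refine Finset.sum_congr rfl fun r _ => Finset.sum_congr rfl fun ρ _ => hsteps _
    _ = ∑ p : (Fin P.d → Fin P.L) × (Fin P.d → Fin (P.L ^ k)), ∑ t' ∈ Finset.range (P.L ^ (k + 1)), F (E p) t' := by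
        rw [Fintype.sum_prod_type]
    _ = ∑ r' : Fin P.d → Fin (P.L ^ (k + 1)), ∑ t' ∈ Finset.range (P.L ^ (k + 1)), F r' t' :=
        Equiv.sum_comp E (fun r' => ∑ t' ∈ Finset.range (P.L ^ (k + 1)), F r' t')

end Summit.QuantumFields.YangMills.Theorems.Prop7OneStrokeSplit

end
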